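import Mathlib.Analysis.Calculus.InverseFunctionTheorem.FDeriv
import Mathlib.Analysis.Calculus.MeanValue
import Mathlib.Analysis.Normed.Module.Complemented
import Mathlib.Analysis.Normed.Operator.Prod
import Mathlib.MeasureTheory.Function.Jacobian
import Mathlib.MeasureTheory.Measure.Haar.Unique
import Mathlib.Topology.Algebra.Module.FiniteDimension
import HarnessLib

/-!
# A submersion at a point pushes Lebesgue measure forward to a measure bounded below, locally and uniformly in parameters

Analysis/Calculus support file (serves the provefact unit of
`Literature.MathematicalPhysics.KineticTheory.HeatConduction.CuneoEckmannHairerReyBellet2018_thm213`: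
the local minorisation of the transition probabilities of the Langevin-driven pinned chain near
its equilibrium by a finite-dimensional, Hörmander-free argument — conditionally on the Brownian
bridges, the solution at time `1` is a `C¹` function of finitely many Gaussian increments whose
differential at the zero path is onto; the present file turns "onto differential" into "image
measure bounded below by Lebesgue measure near the image point", uniformly in the initial
condition and the bridges). Everything here is PROVED from Mathlib; no named facts. The
qualitative companion "submersions pull null sets back to null sets" is
`Literature/Analysis/Calculus/SubmersionNullPreimage.lean`, whose construction we follow.

**Theorem** (`exists_measure_preimage_ge_of_surjective`). Let `E`, `F` be finite-dimensional
real normed spaces (`E ≠ 0`) with additive Haar measures `μ`, `ν`, `P` a topological space of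
parameters, and `f : P → E → F` with a candidate partial differential `f' : P → E → (E →L F)`
such that `f p` has differential `f' p x` at `x` for `(p, x)` near `(p₀, a)`,
`(p, x) ↦ f' p x` is continuous at `(p₀, a)`, `p ↦ f p a` is continuous at `p₀`, and `f' p₀ a`
is ONTO. Then there are a neighbourhood `V` of `p₀`, radii `ρ, r > 0` and a constant `c > 0` with

  `μ {x ∈ closedBall a ρ | f p x ∈ T} ≥ c · ν(T)` for all `p ∈ V` and all measurable
  `T ⊆ ball (f p₀ a) r`.

## The proof

Let `K = ker f'(p₀, a)`, `π : E →L K` a continuous projection onto `K`, and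
`M = (f'(p₀,a), π) : E ≃L F × K` (`ContinuousLinearMap.equivProdOfSurjectiveOfIsCompl`). The
self-maps `Ψ_p = M⁻¹ ∘ (f p, π)` of `E` have differentials `DΨ_p(x) = M⁻¹ ∘ (f'(p,x), π) → id` as
`(p, x) → (p₀, a)`, so for `(p, x)` in a product neighbourhood `V × B̄(a, ρ)` the maps `Ψ_p`
approximate the identity (`ApproximatesLinearOn`, by the mean value theorem) with a constant `δ₁`
so small that (i) `Ψ_p(B̄(a,ρ)) ⊇ B̄(Ψ_p a, (1-δ₁)ρ) ⊇ B̄(Ψ_{p₀} a, ρ/2)` (Mathlib's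
`ApproximatesLinearOn.surjOn_closedBall_of_nonlinearRightInverse`, and continuity of
`p ↦ Ψ_p a`), and (ii) `μ(Ψ_p(A)) ≤ 2 μ(A)` for every `A ⊆ B̄(a, ρ)` (Mathlib's
`addHaar_image_le_mul_of_det_lt`). For measurable `T ⊆ B(f p₀ a, r)` put
`S = M⁻¹(T × B̄_K(π a, r_K)) ⊆ B̄(Ψ_{p₀} a, ρ/2)` and `A = B̄(a,ρ) ∩ Ψ_p⁻¹(S)`; then `S ⊆ Ψ_p(A)`,
so `μ(S) ≤ 2μ(A)`, while `A ⊆ {x ∈ B̄(a,ρ) | f p x ∈ T}` (apply `M`); and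
`μ(S) = c₁ ν(T) λ_K(B̄_K)` because `M_*μ` is an additive Haar measure on `F × K`, hence a positive
multiple of `ν ⊗ λ_K` (`Measure.isAddLeftInvariant_eq_smul`).

## References

* H. Federer, *Geometric Measure Theory* (1969), 3.2.3–3.2.12 (area and co-area); the present
  statement is the elementary "a submersion is open in measure" estimate. [folklore]
-/

noncomputable section

open MeasureTheory Set Filter Topology Metric
open scoped NNReal ENNReal

namespace Literature.Analysis.Calculus

variable {E F : Type*} [NormedAddCommGroup E] [NormedSpace ℝ E] [FiniteDimensional ℝ E]
  [MeasurableSpace E] [BorelSpace E] [NormedAddCommGroup F] [NormedSpace ℝ F]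
  [FiniteDimensional ℝ F] [MeasurableSpace F] [BorelSpace F]
  (μ : Measure E) [μ.IsAddHaarMeasure] (ν : Measure F) [ν.IsAddHaarMeasure]

/-- **Onto differential ⟹ image measure bounded below by Lebesgue measure, locally uniformly in
parameters.** See the module docstring. [folklore] -/
theorem exists_measure_preimage_ge_of_surjective [Nontrivial E] {P : Type*} [TopologicalSpace P]
    (f : P → E → F) (f' : P → E → E →L[ℝ] F) {p₀ : P} {a : E}
    (hf' : ∀ᶠ q : P × E in 𝓝 (p₀, a), HasFDerivAt (f q.1) (f' q.1 q.2) q.2)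
    (hcont' : ContinuousAt (fun q : P × E => f' q.1 q.2) (p₀, a))
    (hcont : ContinuousAt (fun p => f p a) p₀)
    (hsurj : LinearMap.range (f' p₀ a : E →ₗ[ℝ] F) = ⊤) :
    ∃ V ∈ 𝓝 p₀, ∃ ρ : ℝ, 0 < ρ ∧ ∃ r : ℝ, 0 < r ∧ ∃ c : ℝ≥0∞, 0 < c ∧
      ∀ p ∈ V, ∀ T ⊆ ball (f p₀ a) r, MeasurableSet T →
        c * ν T ≤ μ (closedBall a ρ ∩ f p ⁻¹' T) := by
  set f'₀ : E →L[ℝ] F := f' p₀ a with hf'₀def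
  -- a continuous projection onto the kernel, and the linear isomorphism `M = (f'₀, π)`
  obtain ⟨pK, hpK⟩ := f'₀.ker_closedComplemented_of_finiteDimensional_range
  let K : Submodule ℝ E := LinearMap.ker (f'₀ : E →ₗ[ℝ] F)
  have hp' : ∀ x : K, (pK : E →ₗ[ℝ] K) x = x := fun x => hpK x
  have hp_range : LinearMap.range (pK : E →ₗ[ℝ] K) = ⊤ := LinearMap.range_eq_of_proj hp'
  have hcompl : IsCompl K (LinearMap.ker (pK : E →ₗ[ℝ] K)) := LinearMap.isCompl_of_proj hp'
  set M : E ≃L[ℝ] F × K := f'₀.equivProdOfSurjectiveOfIsCompl pK hsurj hp_range hcompl with hMdef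
  have hM : ∀ x, M x = (f'₀ x, pK x) := fun x => rfl
  -- the self-maps `Ψ_p = M⁻¹ ∘ (f p, π)` and their differentials
  set Ψ : P → E → E := fun p x => M.symm (f p x, pK x) with hΨdef
  set D : P → E → E →L[ℝ] E := fun p x => (M.symm : F × K →L[ℝ] E).comp ((f' p x).prod pK)
    with hDdef
  have hΨderiv : ∀ p x, HasFDerivAt (f p) (f' p x) x → HasFDerivAt (Ψ p) (D p x) x :=
    fun p x hx => M.symm.hasFDerivAt.comp x (hx.prodMk pK.hasFDerivAt)
  have hDa : D p₀ a = ContinuousLinearMap.id ℝ E := by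
    ext x
    change M.symm (f'₀ x, pK x) = x
    rw [← hM x, ContinuousLinearEquiv.symm_apply_apply]
  have hDcont : ContinuousAt (fun q : P × E => D q.1 q.2) (p₀, a) := by
    have h2 : Continuous fun A : E →L[ℝ] F => (M.symm : F × K →L[ℝ] E).comp (A.prod pK) := by
      have h3 : Continuous fun A : E →L[ℝ] F => A.prod pK :=
        (ContinuousLinearMap.prodₗᵢ ℝ).continuous.comp (continuous_id.prodMk continuous_const)
      exact continuous_const.clm_comp h3
    exact h2.continuousAt.comp hcont'
  -- the Jacobian constant: `μ(g(A)) ≤ 2 μ(A)` for maps `δ₁`-approximating the identity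
  have hJ := addHaar_image_le_mul_of_det_lt μ (ContinuousLinearMap.id ℝ E) (m := 2)
    (by simp [ContinuousLinearMap.det])
  obtain ⟨δ₁, ⟨hδ₁J, hδ₁0, hδ₁le⟩⟩ := (hJ.and (Ioc_mem_nhdsGT (show (0 : ℝ≥0) < 1 / 4 by norm_num))).exists
  -- the product neighbourhood on which `Ψ_p` is `δ₁`-close to the identity
  have hsmall : ∀ᶠ q : P × E in 𝓝 (p₀, a), ‖D q.1 q.2 - ContinuousLinearMap.id ℝ E‖₊ ≤ δ₁ := by
    have ht : Tendsto (fun q : P × E => D q.1 q.2 - ContinuousLinearMap.id ℝ E) (𝓝 (p₀, a)) (𝓝 0) := by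
      have := hDcont.tendsto.sub_const (ContinuousLinearMap.id ℝ E)
      rwa [show D (p₀, a).1 (p₀, a).2 = ContinuousLinearMap.id ℝ E from hDa, sub_self] at this
    have h1 : ∀ᶠ q : P × E in 𝓝 (p₀, a), ‖D q.1 q.2 - ContinuousLinearMap.id ℝ E‖ < δ₁ :=
      (NormedAddGroup.tendsto_nhds_zero.1 ht) δ₁ (by exact_mod_cast hδ₁0)
    exact h1.mono fun q hq => by
      rw [← NNReal.coe_le_coe, coe_nnnorm]
      exact hq.le
  obtain ⟨V₁, hV₁, W, hW, hVW⟩ := mem_nhds_prod_iff.1 (hf'.and hsmall)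
  obtain ⟨ρ₁, hρ₁, hρ₁W⟩ := Metric.mem_nhds_iff.1 hW
  set ρ : ℝ := ρ₁ / 2 with hρdef
  have hρ : 0 < ρ := half_pos hρ₁
  have hballW : closedBall a ρ ⊆ W := fun x hx => hρ₁W (mem_ball.2 (lt_of_le_of_lt
    (mem_closedBall.1 hx) (half_lt_self hρ₁)))
  have hder : ∀ p ∈ V₁, ∀ x ∈ closedBall a ρ, HasFDerivAt (Ψ p) (D p x) x := fun p hp x hx =>
    hΨderiv p x (hVW (mk_mem_prod hp (hballW hx))).1
  have hbound : ∀ p ∈ V₁, ∀ x ∈ closedBall a ρ, ‖D p x - ContinuousLinearMap.id ℝ E‖₊ ≤ δ₁ :=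
    fun p hp x hx => (hVW (mk_mem_prod hp (hballW hx))).2
  -- `Ψ_p` approximates the identity on the closed ball
  have happrox : ∀ p ∈ V₁, ApproximatesLinearOn (Ψ p) (ContinuousLinearMap.id ℝ E : E →L[ℝ] E)
      (closedBall a ρ) δ₁ := by
    intro p hp
    refine LipschitzOnWith.approximatesLinearOn ?_
    refine (convex_closedBall a ρ).lipschitzOnWith_of_nnnorm_hasFDerivWithin_le
      (f' := fun x => D p x - ContinuousLinearMap.id ℝ E) (fun x hx => ?_) (hbound p hp)
    exact ((hder p hp x hx).sub (ContinuousLinearMap.id ℝ E).hasFDerivAt).hasFDerivWithinAt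
  -- hence is onto a ball of radius `(1 - δ₁) ρ`
  have hsurjΨ : ∀ p ∈ V₁, closedBall (Ψ p a) ((1 - δ₁) * ρ) ⊆ Ψ p '' closedBall a ρ := by
    intro p hp y hy
    have h := (happrox p hp).surjOn_closedBall_of_nonlinearRightInverse
      ((ContinuousLinearEquiv.refl ℝ E).toNonlinearRightInverse) hρ.le Subset.rfl
    have hn : ((ContinuousLinearEquiv.refl ℝ E).toNonlinearRightInverse).nnnorm = 1 := by
      show ‖((ContinuousLinearEquiv.refl ℝ E).symm : E →L[ℝ] E)‖₊ = 1
      simp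
    rw [hn] at h
    have hy' : y ∈ closedBall (Ψ p a) ((((1 : ℝ≥0) : ℝ)⁻¹ - δ₁) * ρ) := by simpa using hy
    exact h hy'
  -- continuity of `p ↦ Ψ_p a`: the image contains a FIXED ball `B̄(Ψ_{p₀} a, ρ/2)`
  have hΨcont : ContinuousAt (fun p => Ψ p a) p₀ :=
    M.symm.continuous.continuousAt.comp (hcont.prodMk continuousAt_const)
  obtain ⟨V₂, hV₂, hV₂sub⟩ : ∃ V₂ ∈ 𝓝 p₀, ∀ p ∈ V₂, dist (Ψ p a) (Ψ p₀ a) < ρ / 4 := by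
    have := Metric.tendsto_nhds.1 hΨcont (ρ / 4) (by positivity)
    exact ⟨_, this, fun p hp => hp⟩
  have hfixed : ∀ p ∈ V₁ ∩ V₂, closedBall (Ψ p₀ a) (ρ / 2) ⊆ Ψ p '' closedBall a ρ := by
    intro p hp y hy
    refine hsurjΨ p hp.1 (mem_closedBall.2 ?_)
    have h1 : dist y (Ψ p₀ a) ≤ ρ / 2 := mem_closedBall.1 hy
    have h2 : dist (Ψ p a) (Ψ p₀ a) < ρ / 4 := hV₂sub p hp.2
    have h3 : (δ₁ : ℝ) ≤ 1 / 4 := by exact_mod_cast hδ₁le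
    calc dist y (Ψ p a) ≤ dist y (Ψ p₀ a) + dist (Ψ p₀ a) (Ψ p a) := dist_triangle _ _ _
      _ ≤ ρ / 2 + ρ / 4 := by rw [dist_comm (Ψ p₀ a)]; linarith
      _ ≤ (1 - δ₁) * ρ := by nlinarith
  -- the radii in `F` and `K`
  set L : ℝ := ‖(M.symm : F × K →L[ℝ] E)‖ with hLdef
  have hL0 : 0 ≤ L := by rw [hLdef]; exact norm_nonneg (M.symm : F × K →L[ℝ] E)
  set r : ℝ := ρ / (2 * (L + 1)) with hrdef
  have hr : 0 < r := by positivity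
  have hrL : L * r ≤ ρ / 2 := by
    rw [hrdef]
    rw [mul_div_assoc', div_le_div_iff₀ (by positivity) (by positivity)]
    nlinarith
  -- Haar transport: `M_* μ = c₁ • (ν ⊗ λ_K)`
  haveI : (μ.map M).IsAddHaarMeasure := M.isAddHaarMeasure_map μ
  have hsmul := Measure.isAddLeftInvariant_eq_smul (μ.map M) (ν.prod (Measure.addHaar : Measure K))
  set c₁ : ℝ≥0 := Measure.addHaarScalarFactor (μ.map M) (ν.prod (Measure.addHaar : Measure K))
    with hc₁def
  have hc₁ : 0 < c₁ := Measure.addHaarScalarFactor_pos_of_isAddHaarMeasure _ _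
  set BK : Set K := closedBall (pK a) r with hBKdef
  have hBK : 0 < (Measure.addHaar : Measure K) BK := measure_closedBall_pos _ _ hr
  -- the constant
  refine ⟨V₁ ∩ V₂, inter_mem hV₁ hV₂, ρ, hρ, r, hr,
    2⁻¹ * ((c₁ : ℝ≥0∞) * (Measure.addHaar : Measure K) BK), ?_, fun p hp T hT hTm => ?_⟩
  · refine ENNReal.mul_pos (by simp) (ENNReal.mul_pos (by exact_mod_cast hc₁.ne') hBK.ne').ne' |>.bot_lt
  -- the set `S = M⁻¹(T × B_K)` and its preimage `A` under `Ψ_p` in the ball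
  set S : Set E := M ⁻¹' (T ×ˢ BK) with hSdef
  have hS_sub : S ⊆ closedBall (Ψ p₀ a) (ρ / 2) := by
    intro x hx
    rw [hSdef, mem_preimage, mem_prod] at hx
    rw [mem_closedBall, dist_eq_norm]
    have hx1 : dist (M x).1 (f p₀ a) < r := mem_ball.1 (hT hx.1)
    have hx2 : dist (M x).2 (pK a) ≤ r := mem_closedBall.1 hx.2
    have heq : x - Ψ p₀ a = M.symm (M x - (f p₀ a, pK a)) := by
      rw [map_sub, ContinuousLinearEquiv.symm_apply_apply]
    rw [heq]
    calc ‖M.symm (M x - (f p₀ a, pK a))‖ ≤ L * ‖M x - (f p₀ a, pK a)‖ :=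
          (M.symm : F × K →L[ℝ] E).le_opNorm _
      _ ≤ L * r := by
          refine mul_le_mul_of_nonneg_left ?_ hL0
          rw [Prod.norm_def]
          refine max_le ?_ ?_
          · rw [Prod.fst_sub, ← dist_eq_norm]; exact hx1.le
          · rw [Prod.snd_sub, ← dist_eq_norm]; exact hx2
      _ ≤ ρ / 2 := hrL
  set A : Set E := closedBall a ρ ∩ Ψ p ⁻¹' S with hAdef
  have hA_image : S ⊆ Ψ p '' A := by
    intro x hx
    obtain ⟨w, hw, rfl⟩ := hfixed p hp (hS_sub hx)
    exact ⟨w, ⟨hw, hx⟩, rfl⟩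
  have hμS : μ S ≤ 2 * μ A :=
    (measure_mono hA_image).trans (hδ₁J A (Ψ p) ((happrox p hp.1).mono_set inter_subset_left))
  have hA_sub : A ⊆ closedBall a ρ ∩ f p ⁻¹' T := by
    rintro x ⟨hx, hxS⟩
    refine ⟨hx, ?_⟩
    rw [mem_preimage, hSdef, mem_preimage] at hxS
    change M (M.symm (f p x, pK x)) ∈ T ×ˢ BK at hxS
    rw [ContinuousLinearEquiv.apply_symm_apply] at hxS
    exact hxS.1
  -- `μ S = c₁ ν(T) λ_K(B_K)`
  have hμS_eq : μ S = (c₁ : ℝ≥0∞) * (ν T * (Measure.addHaar : Measure K) BK) := by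
    rw [hSdef, ← Measure.map_apply M.continuous.measurable (hTm.prod measurableSet_closedBall), hsmul,
      Measure.smul_apply, Measure.prod_prod]
    rfl
  -- conclude
  calc 2⁻¹ * ((c₁ : ℝ≥0∞) * (Measure.addHaar : Measure K) BK) * ν T = 2⁻¹ * μ S := by
        rw [hμS_eq]; ring
    _ ≤ 2⁻¹ * (2 * μ A) := mul_le_mul' le_rfl hμS
    _ = μ A := by rw [← mul_assoc, ENNReal.inv_mul_cancel two_ne_zero ENNReal.ofNat_ne_top, one_mul]
    _ ≤ μ (closedBall a ρ ∩ f p ⁻¹' T) := measure_mono hA_sub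

end Literature.Analysis.Calculus
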